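import Summits.BirchSwinnertonDyer.BirchSwinnertonDyer.Theorems.ResidualThetaTransportAtTwoResidualSignedLambdaLowerCMAtTwoRhoLayerPairingGlueAwayTwo
import HarnessLib

/-!
# GLUE clause (4), 2-adic half: a class STRICT at `2` (Kummer datum with `2^k Q = 0`) is killed by the local value character `c₂` of `AtTwoPins`

Route `ResidualThetaTransportAtTwo` (RTT), crux RSL_g `ResidualSignedLambdaLowerCMAtTwo` (stmt-BirchSwinnertonDyer-22608); LEAD `prover-bsd-wall-rtt-p2` g18
(`--supports 22608 --as helper`, closes nothing). THEOREMS ONLY. BSD is not proved by any of this. GLUE-SPEC-g18 §2 (4) «horth»: the N5 binder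
`∀ s ∈ Sel₀, ∀ t, pair t s = 0` splits into the 2-adic summand (this file: `Sel₀`'s first clause in `OnePairPins.hSel₀` = a Θ-Kummer datum with
`2^k Q_i = 0`, so the VALUE PIN `AtTwoPins.hc₂` evaluates `t` on the zero tuple) and the `S₀`-summands (primitive ⟹ locally trivial at `w ∤ 2`, width seat w3).

* `c₂_locKer_eq_zero_of_strictDatum` — for a global class `s` with a strict Θ-Kummer datum at `π.v` (σ = 1), `π₂.c₂ t (locKer … π.v s) = 0` for every `t`
  (bridge `ThetaTransport.locKer_oneCocycleClass` / `locKer_pullback_apply`, p700007).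
* `c₂_locKer_eq_zero_of_mem_Sel₀` — hence for every `s ∈ π.Sel₀`.

References: [Kobayashi2003] Thm. 6.2, (8.23); [MilneADT2006] Ch. I §6; [PerrinRiou1994Invent] §3.6.1.
-/

set_option autoImplicit false
-- the Theorems namespace of this sub repeats the summit name by design (D-0017 nested layout)
set_option linter.dupNamespace false

noncomputable section

open scoped Classical

namespace Summit.BirchSwinnertonDyer.BirchSwinnertonDyer.Theorems.OnePair

open CategoryTheory Field NumberField IsDedekindDomain
  Literature.NumberTheory.EllipticCurves Literature.NumberTheory.GaloisRepresentations
  Literature.NumberTheory.EllipticCurves.GreenbergSelmer Literature.NumberTheory.EllipticCurves.CyclotomicLayer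
  Literature.NumberTheory.EllipticCurves.Kato2004 ZpExtension
  Summit.BirchSwinnertonDyer.BirchSwinnertonDyer.Theorems.ThetaTransport

variable {S : Set (PadicAlgCl 2)} {κ : ZpExtension ℚ 2} {ρ : FramedGaloisRep ℚ ↥(padicCoeffIntegers S) 2}
  {S₀ : Finset (HeightOneSpectrum (𝓞 ℚ))} {W : WeierstrassCurve ℚ} [W.IsElliptic] {γ : absoluteGaloisGroup ℚ} {n : ℕ}
  {Θ : ∀ v : HeightOneSpectrum (𝓞 ℚ), ((2 : ℕ) : 𝓞 ℚ) ∈ v.asIdeal → (Cofree ρ ↥(padicCoeffField S) ≃+ (Fin n → ↥(W.geomPrimaryTorsion 2)))}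
  {hΘ : ∀ v hv (δ : absoluteGaloisGroup (v.adicCompletion ℚ)) m i,
    Θ v hv (resGalOfEmb (closureEmb (K := ℚ) (v.adicCompletion ℚ)) δ • m) i = resGalOfEmb (closureEmb (K := ℚ) (v.adicCompletion ℚ)) δ • Θ v hv m i}
  {I : Kato2004.IwasawaH1DataCoeff (FramedGaloisRep.toGaloisRep ρ) 2 κ γ}
  {Sg : AddSubgroup (subgroupH1 κ.kerSubgroup (Cofree ρ ↥(padicCoeffField S)))} [Module ↥(padicCoeffIntegers S) ↥Sg]
  (π : OnePairPins S W κ γ S₀ n ρ Θ hΘ I Sg) [Module ℤ_[2] (Dloc S κ ρ π.v)] (π₂ : AtTwoPins S κ ρ S₀ W γ n Θ hΘ I Sg π)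

/-- **A strict Θ-Kummer datum kills the local value character.** If the global class `s` is represented (at `σ = 1`) by a cocycle `φ` whose
restriction to `U_{∞,v}` is, through `Θ`, the Kummer cocycle of a tuple `Q` with `2^k • Q_i = 0`, then `π₂.c₂ t (loc₂ s) = 0` for every functional `t`:
the pulled-back cocycle is a LOCAL datum (`locKer_oneCocycleClass`, `locKer_pullback_apply`) with the ZERO tuple `2^k Q = 0`, so the VALUE PIN gives
`(t 0 mod 2^k) · 2^{-k} = 0`. [cite: Kobayashi2003, Thm. 6.2 and (8.23) (p. 18)] [cite: MilneADT2006, Ch. I §6, proof of Prop. 6.9] -/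
theorem c₂_locKer_eq_zero_of_strictDatum (s : subgroupH1 κ.kerSubgroup (Cofree ρ ↥(padicCoeffField S)))
    (φ : contOneCocycles (discreteTopRep ↥κ.kerSubgroup (Cofree ρ ↥(padicCoeffField S))))
    (Q : Fin n → localPoints W (π.v.adicCompletion ℚ)) (k : ℕ)
    (hφ : oneCocycleClass (discreteTopRep ↥κ.kerSubgroup (Cofree ρ ↥(padicCoeffField S))) φ = s)
    (hQ : ∀ i, (2 ^ k) • Q i ∈ (⊥ : AddSubgroup (localPoints W (π.v.adicCompletion ℚ))))
    (hkum : ∀ (τ : ↥(localSubgroupOfEmb κ.kerSubgroup (closureEmb (K := ℚ) (π.v.adicCompletion ℚ)))) (i : Fin n),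
      pointsMapOfEmb W (closureEmb (K := ℚ) (π.v.adicCompletion ℚ))
        ((Θ π.v π.hv (φ.1 (resGalSubgroupOfEmb κ.kerSubgroup (closureEmb (K := ℚ) (π.v.adicCompletion ℚ)) τ)) i :
          ↥(W.geomPrimaryTorsion 2)) : W.geomPoints) = (τ : absoluteGaloisGroup (π.v.adicCompletion ℚ)) • Q i - Q i)
    (t : (Fin n → ↥(Sprung2012.localTowerPointsOfEmb κ (closureEmb (K := ℚ) (π.v.adicCompletion ℚ)) W)) →+ ℤ_[2]) :
    π₂.c₂ t (locKer S κ ρ π.v s) = 0 := by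
  have hQ0 : ∀ i, (2 ^ k) • Q i = 0 := fun i ↦ (AddSubgroup.mem_bot.mp (hQ i))
  have hQt : ∀ i, (2 ^ k) • Q i ∈ Sprung2012.localTowerPointsOfEmb κ (closureEmb (K := ℚ) (π.v.adicCompletion ℚ)) W :=
    fun i ↦ by rw [hQ0 i]; exact AddSubgroup.zero_mem _
  -- the pulled-back cocycle is a local Θ-Kummer datum of `loc₂ s`
  have hloc := locKer_oneCocycleClass S κ ρ π.v φ
  rw [← hφ, hloc]
  rw [π₂.hc₂ t _ _ Q k hQt rfl (fun τ i ↦ hkum τ i)]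
  have h0 : (fun i => (⟨(2 ^ k) • Q i, hQt i⟩ :
      ↥(Sprung2012.localTowerPointsOfEmb κ (closureEmb (K := ℚ) (π.v.adicCompletion ℚ)) W))) = 0 :=
    funext fun i ↦ Subtype.ext (hQ0 i)
  rw [h0, map_zero, map_zero, ZMod.val_zero, zero_smul]

/-- **`Sel₀` kills the local value character at `2`** (the 2-adic half of N5's `horth`): for `s ∈ π.Sel₀` — strict at every place above `2`
(`OnePairPins.hSel₀`, clause 1, at `π.v` and `σ = 1`, `conjH1 1 = id`) — `π₂.c₂ t (loc₂ s) = 0`. [cite: Kobayashi2003, Thm. 6.2 (p. 18)]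
[cite: MilneADT2006, Ch. I, Thm. 4.10] -/
theorem c₂_locKer_eq_zero_of_mem_Sel₀ (s : ↥Sg) (hs : s ∈ π.Sel₀)
    (t : (Fin n → ↥(Sprung2012.localTowerPointsOfEmb κ (closureEmb (K := ℚ) (π.v.adicCompletion ℚ)) W)) →+ ℤ_[2]) :
    π₂.c₂ t (locKer S κ ρ π.v (s : subgroupH1 κ.kerSubgroup (Cofree ρ ↥(padicCoeffField S)))) = 0 := by
  have h := ((π.mem_Sel₀_iff s).mp hs).1 π.v π.hv 1
  refine h.elim fun φ hφ ↦ hφ.elim fun Q hQ ↦ hQ.elim fun k hk ↦ ?_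
  refine c₂_locKer_eq_zero_of_strictDatum π π₂ _ φ Q k ?_ hk.2.1 hk.2.2 t
  rw [hk.1, conjH1_one_holds κ.kerSubgroup (Cofree ρ ↥(padicCoeffField S)), AddMonoidHom.id_apply]

end Summit.BirchSwinnertonDyer.BirchSwinnertonDyer.Theorems.OnePair

end
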